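import Literature.NumberTheory.EllipticCurves.HeegnerPointsKolyvaginPairing
import Literature.NumberTheory.EllipticCurves.KummerMap
import Literature.NumberTheory.EllipticCurves.SelmerProofs
import HarnessLib

/-!
# Kummer classes of rational points over an extension are `Aut(K/k)`-invariant
# (helper for the refutation of Q5 `EquivariantChebotarevAtTwo`, stmt-BirchSwinnertonDyer-24881;
# seat gk2-p2 g8; route-independent — no `Theses` import)

For `E = W/k`, a field extension `K/k`, `σ ∈ Aut(K/k)` and a point `P ∈ E(K)` coming from `E(k)`,
the Kummer class `κ(P) = [g ↦ gQ − Q] ∈ H¹(K, E[n])` (`nQ = P`) is fixed by the action `σ_*` of the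
tree (`Literature.NumberTheory.EllipticCurves.conjAct`, transport along a lift `τ` of `σ` to `K̄`):
on cocycles `σ_* κ(Q) = κ(τQ)` (`conjH1_kummerClassTorsion`), and `τQ` is another `n`-th root of
`τP = P`, so the classes agree (Silverman AEC VIII.2: `δ` is well defined). Together with the kernel
of the Kummer map (`kummerMapTorsion_ker`: `κ(P) = 0 ↔ P ∈ nE(K)`) this supplies, for `K` imaginary
quadratic and `c` its conjugation, `c`-INVARIANT classes in `H¹(K, E[2])` that are non-zero /
distinct as soon as the corresponding points are not `2`-divisible in `E(K)` — the input of
`GenusExact.equivariantChebotarevAtTwo_false_of_two_invariant` (p618040).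

* `conjH1_kummerClassTorsion`, `conjAct_kummerClassTorsion_of_pointsMap_eq` (any `k ⊆ K`, any `n`);
* `pointsMap_toGeomPoints_some` — a lift of `σ` fixes the geometric point of a `k`-rational point;
* `conjAct_kummerMapTorsion_some` — **`σ_* κ(P) = κ(P)` for `P = (x, y)` with `x, y ∈ k`**;
* `kummerMapTorsion_ne_zero_of_not_exists`, `kummerMapTorsion_ne_of_not_exists` — non-vanishing /
  distinctness from non-divisibility (`n = 2`: `κ(P₁) = κ(P₂) ⇒ P₁ + P₂ ∈ 2E(K)`).

THEOREMS ONLY (no definition, no named fact, no `sorry`); helper `--supports 24881`; BSD is not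
proved by any of this.

References: [SilvermanAEC2009] VIII.2 (Kummer pairing, well-definedness of `δ`), X.4;
[GrossLMS1991] §5 (5.1) (the action of `Gal(K/ℚ)` on `H¹(K, E_p)`).
-/

set_option autoImplicit false
set_option linter.dupNamespace false

noncomputable section

open scoped Classical

namespace Summit.BirchSwinnertonDyer.BirchSwinnertonDyer.Theorems.GenusExact

open WeierstrassCurve Field
open Literature.NumberTheory.GaloisRepresentations Literature.NumberTheory.EllipticCurves
open Literature.NumberTheory

universe u v

section Conj

variable {k : Type v} {K : Type u} [Field k] [Field K] [Algebra k K] (W : WeierstrassCurve k)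
variable {σ : K ≃ₐ[k] K} {τ : AlgebraicClosure K ≃+* AlgebraicClosure K}

/-- A lift `τ` preserves "`n • Q` is `Γ_K`-fixed" when it fixes `n • Q`. [folklore] -/
theorem zsmul_pointsMap_mem_fixedPoints (hτ : IsLiftOfAut σ τ) (n : ℤ)
    {Q : geomPoints (W.baseChange K)}
    (hQ : n • Q ∈ MulAction.fixedPoints (absoluteGaloisGroup K) (geomPoints (W.baseChange K)))
    (hfix : hτ.pointsMap W (n • Q) = n • Q) :
    n • hτ.pointsMap W Q ∈
      MulAction.fixedPoints (absoluteGaloisGroup K) (geomPoints (W.baseChange K)) := by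
  rw [← map_zsmul, hfix]; exact hQ

/-- **`σ_*` on a Kummer class, on the nose:** `conjH1 [g ↦ gQ − Q] = [g ↦ g(τQ) − τQ]` — the
pulled-back cocycle `g ↦ τ((τ⁻¹gτ)Q − Q)` IS the Kummer cocycle of `τQ` (compatibility
`τ(τ⁻¹gτ • Q) = g • τQ`, `IsLiftOfAut.pointsMap_smul`).
[cite: SilvermanAEC2009, VIII.2 (Kummer pairing, properties of δ)] -/
theorem conjH1_kummerClassTorsion (hτ : IsLiftOfAut σ τ) (n : ℤ)
    (Q : geomPoints (W.baseChange K))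
    (hQ : n • Q ∈ MulAction.fixedPoints (absoluteGaloisGroup K) (geomPoints (W.baseChange K)))
    (hQ' : n • hτ.pointsMap W Q ∈
      MulAction.fixedPoints (absoluteGaloisGroup K) (geomPoints (W.baseChange K))) :
    hτ.conjH1 W n (kummerClassTorsion (W.baseChange K) n Q hQ) =
      kummerClassTorsion (W.baseChange K) n (hτ.pointsMap W Q) hQ' := by
  unfold IsLiftOfAut.conjH1 kummerClassTorsion
  rw [LinearMap.toAddMonoidHom_coe, ContinuousLinearMap.coe_coe, map_oneCocycleClass]
  congr 1
  apply Subtype.ext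
  ext g : 1
  apply Subtype.ext
  rw [contOneCocycles.pullback_apply]
  change hτ.pointsMap W (hτ.conjGalCMH g • Q - Q) = g • hτ.pointsMap W Q - hτ.pointsMap W Q
  rw [map_sub, hτ.pointsMap_smul]

/-- **`σ_* κ(Q) = κ(Q)` when the lift fixes `n • Q`:** then `τQ` and `Q` are two `n`-th roots of the
same rational point and define the same class. [cite: SilvermanAEC2009, VIII.2 (δ is well defined)] -/
theorem conjAct_kummerClassTorsion_of_pointsMap_eq (hτ : IsLiftOfAut σ τ) (n : ℤ)
    (Q : geomPoints (W.baseChange K))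
    (hQ : n • Q ∈ MulAction.fixedPoints (absoluteGaloisGroup K) (geomPoints (W.baseChange K)))
    (hfix : hτ.pointsMap W (n • Q) = n • Q) :
    conjAct W σ n (kummerClassTorsion (W.baseChange K) n Q hQ) =
      kummerClassTorsion (W.baseChange K) n Q hQ := by
  have hQ' := zsmul_pointsMap_mem_fixedPoints W hτ n hQ hfix
  rw [← hτ.conjH1_eq_conjAct W n, conjH1_kummerClassTorsion W hτ n Q hQ hQ']
  exact kummerClassTorsion_eq_of_zsmul_eq _ n _ _ hQ' hQ (by rw [← map_zsmul, hfix])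

/-- **A lift of `σ ∈ Aut(K/k)` fixes the geometric point of a `k`-RATIONAL point** `(x, y)`,
`x, y ∈ k` (its coordinates in `K̄` are `k`-rational and `τ` is `k`-linear). [folklore] -/
theorem pointsMap_toGeomPoints_some (hτ : IsLiftOfAut σ τ) {x y : k}
    (h : (W.baseChange K).toAffine.Nonsingular (algebraMap k K x) (algebraMap k K y)) :
    hτ.pointsMap W (toGeomPoints (W.baseChange K) (.some _ _ h)) =
      toGeomPoints (W.baseChange K) (.some _ _ h) := by
  have hx : τ (algebraMap K (AlgebraicClosure K) (algebraMap k K x)) = algebraMap K (AlgebraicClosure K) (algebraMap k K x) := by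
    rw [hτ, AlgEquiv.commutes]
  have hy : τ (algebraMap K (AlgebraicClosure K) (algebraMap k K y)) = algebraMap K (AlgebraicClosure K) (algebraMap k K y) := by
    rw [hτ, AlgEquiv.commutes]
  exact Affine.Point.some_eq_some_of_eq hx hy

end Conj

/-! ### Kummer classes of rational points: invariance, non-vanishing, distinctness -/

section KummerMap

variable {k : Type v} {K : Type u} [Field k] [Field K] [Algebra k K] (W : WeierstrassCurve k)
variable (n : ℤ)
  (hdiv : ∀ P : geomPoints (W.baseChange K), ∃ Q : geomPoints (W.baseChange K), n • Q = P)

/-- **`σ_* κ(P) = κ(P)` for a `k`-rational point.** For `σ ∈ Aut(K/k)` and `P = (x, y) ∈ E(K)` with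
`x, y ∈ k`, the Kummer class `κ(P) ∈ H¹(K, E[n])` is fixed by `conjAct W σ n` (any lift; the class does
not depend on the lift, `IsLiftOfAut.conjH1_eq_conjAct`). In the refutation of Q5: `k = ℚ`, `K`
imaginary quadratic, `σ = c` complex conjugation, `n = 2`. [cite: SilvermanAEC2009, VIII.2 (Kummer pairing, Galois equivariance)]
[cite: GrossLMS1991, §5 (5.1)] -/
theorem conjAct_kummerMapTorsion_some (σ : K ≃ₐ[k] K) {x y : k}
    (h : (W.baseChange K).toAffine.Nonsingular (algebraMap k K x) (algebraMap k K y)) :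
    conjAct W σ n ((W.baseChange K).kummerMapTorsion n hdiv (.some _ _ h)) =
      (W.baseChange K).kummerMapTorsion n hdiv (.some _ _ h) := by
  have hτ := isLiftOfAut_liftAut σ
  rw [kummerMapTorsion_apply]
  unfold kummerMapTorsionFun
  refine conjAct_kummerClassTorsion_of_pointsMap_eq W hτ n _ _ ?_
  rw [zsmul_zsmulRoot]
  exact pointsMap_toGeomPoints_some W hτ h

variable {W n}

/-- **Non-vanishing:** if `P ∉ nE(K)` then `κ(P) ≠ 0` (`ker κ = nE(K)`, Silverman AEC VIII.2 / X.4).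
[cite: SilvermanAEC2009, VIII.2 (exactness of the Kummer sequence at E(K)/mE(K))] -/
theorem kummerMapTorsion_ne_zero_of_not_exists [PerfectField K] {P : (W.baseChange K).toAffine.Point}
    (hP : ¬ ∃ R : (W.baseChange K).toAffine.Point, n • R = P) :
    (W.baseChange K).kummerMapTorsion n hdiv P ≠ 0 := by
  intro h0
  have hmem : P ∈ ((W.baseChange K).kummerMapTorsion n hdiv).ker := h0
  rw [kummerMapTorsion_ker] at hmem
  obtain ⟨R, hR⟩ := hmem
  exact hP ⟨R, hR⟩

/-- **Distinctness at `n = 2`:** if `P₁ + P₂ ∉ 2E(K)` then `κ(P₁) ≠ κ(P₂)` (`κ(P₁) = κ(P₂)` gives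
`κ(P₁ + P₂) = κ(2P₂) = 0`). [cite: SilvermanAEC2009, VIII.2 (exactness of the Kummer sequence at E(K)/mE(K))] -/
theorem kummerMapTorsion_ne_of_not_exists [PerfectField K]
    (hdiv₂ : ∀ P : geomPoints (W.baseChange K), ∃ Q : geomPoints (W.baseChange K), (2 : ℤ) • Q = P)
    {P₁ P₂ : (W.baseChange K).toAffine.Point}
    (hP : ¬ ∃ R : (W.baseChange K).toAffine.Point, (2 : ℤ) • R = P₁ + P₂) :
    (W.baseChange K).kummerMapTorsion 2 hdiv₂ P₁ ≠ (W.baseChange K).kummerMapTorsion 2 hdiv₂ P₂ := by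
  intro he
  have hmem : P₁ + P₂ - (2 : ℤ) • P₂ ∈ ((W.baseChange K).kummerMapTorsion 2 hdiv₂).ker := by
    rw [AddMonoidHom.mem_ker, map_sub, map_add, he, map_zsmul, two_zsmul, sub_self]
  rw [kummerMapTorsion_ker] at hmem
  obtain ⟨R, hR⟩ := hmem
  refine hP ⟨R + P₂, ?_⟩
  have hR' : (2 : ℤ) • R = P₁ + P₂ - (2 : ℤ) • P₂ := hR
  rw [zsmul_add, hR', sub_add_cancel]

end KummerMap

end Summit.BirchSwinnertonDyer.BirchSwinnertonDyer.Theorems.GenusExact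

end
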